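import Summits.Ventures.Crystal3D.Theorems.StickyWulffConstantTextureLiminfTexShadowCoverageBarlowGlue
import HarnessLib

/-!
# TexShadow row (e): the SEMANTIC CUT — dispatch faulted pairs on the certified predicate itself; the K3 engine result sizes the remainder
# but is NOT a proof obligation (lane T, crux `TextureLiminfV5`, stmt-Ventures-23912; answer to cf-p1 Q-v8.4 (ciii)(1) and to DECISION (cvi)(3))

HONEST FRAMING. Venture `Summits/Ventures/Crystal3D` (cell `crystal3d-full`), route `route-Ventures-StickyWulffConstant`, helper
`--supports` the law-v5 crux `TextureLiminfV5` (stmt-Ventures-23912), line `TexShadow` v8.3 → v8.4.  PURE BOOKKEEPING (census-free, standard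
axioms): every wall input is a HYPOTHESIS; no certificate, no cell is proved; rung F-C1 not moved.

THE POINT.  19480-p2's row-(e) closer `residualFaultedCoreAt_of_coverageBarlowOn'` (p694618) takes a certificate `ResidualOneSidedCoverageBarlowOn Reg c₀`
on some orientation regime `Reg` plus the core on a complementary region `Rem`.  Taking **`Reg := BarlowOneSidedCertified c₀` itself** the certificate is
the identity (`coverageBarlowOn_certified`), so the registered core `∃ C, BilayerWallResidualFaultedCoreAt c₀ C R₀` follows from {E1, StarPairFar} and the
core on the SEMANTIC remainder `¬ BarlowOneSidedCertified c₀`, which splits as «edge-on» `EdgeOnAt c₀` (= v8.3's frozen `stub_edgeOn`) ∪ «read holes»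
`¬ EdgeOnAt c₀ ∧ ¬ BarlowOneSidedCertified c₀` (some plate flux-feasible, but every flux-feasible canonical family READS the other plate: a forced chain
frame carries its presented lattice or basal twin — the coincidence datum is IN the hypothesis).  Consequences for v8.4 (cf-p1 (cvi)(3)):
* NO kernel port of the K3 table/378-word list is on the critical path of `BilayerWallV5`: the engine's word-uniform theorem («¬EdgeOn ∧ NonExceptional ⇒
  certified», 19480-p1 g14 first light) MEASURES the read-hole region and, if typed (`…CoverageBarlowK3RegDefs`), shows the semantic read-hole stub is
  implied by (cvi)'s `stub_readHoles` on `HolesK3 := ¬EdgeOn ∧ ¬NonExceptional` (`residualFaultedCoreOnAt_semanticHoles_of_coverageOn`: the semantic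
  region is the SMALLER one) — so the semantic stub is the weaker (easier) registration and needs no list;
* the same two lemmas serve ANY certified predicate with a K1a closer (`residualFaultedCoreAt_of_certCut`: chosen-slot MENU `BarlowMenuCertified` of
  19480-p2's pending `…CoverageBarlowAtDefs/AtGlue`, steered families after (ε)) — each enlargement of `Cert` shrinks the read-hole stub by
  `residualFaultedCoreOnAt_anti`, no re-cut.
CONTENTS: `residualFaultedCoreOnAt_anti`, `residualFaultedCoreOnAt_union`, `coverageBarlowOn_certified`, `residualFaultedCoreAt_of_certCut`,
`residualFaultedCoreAt_of_semanticCut(')`, `residualFaultedCoreOnAt_semanticHoles_of_coverageOn`, **`stub_residualFaultedCore_of_semanticCut :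
P5Exhaustion → StarPairFar → (∃ C, …CoreOnAt (¬EdgeOn ∧ ¬Certified) (13/25) C 10) → (∃ C, …EdgeOnAt (13/25) C 10) → ∃ C, …CoreAt (13/25) C 10`**.
WHAT THIS IS NOT: no certificate, no K4, no read-hole cell; F-C1 not moved.
-/

noncomputable section

namespace Summit.Ventures.Crystal3D.Cruxes.TextureLiminf.TexShadow

open Summit.Ventures.Crystal3D Summit.Ventures.Crystal3D.Theorems Finset
open Literature.MathematicalPhysics.StatisticalMechanics (IsHaggSeq fccStacking barlowStacking basalMirror)
open scoped InnerProductSpace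

/-! ## Region bookkeeping for the core -/

/-- **The core-on-a-region is antitone in the region**: a core on `Rem` restricts to every `Rem' ⊆ Rem`. -/
theorem residualFaultedCoreOnAt_anti
    {Rem Rem' : (ℤ → ℤ) → (ℤ → ℤ) → (E3 ≃ₗᵢ[ℝ] E3) → (E3 ≃ₗᵢ[ℝ] E3) → Prop}
    (hle : ∀ σ₁ σ₂ L₁ L₂, Rem' σ₁ σ₂ L₁ L₂ → Rem σ₁ σ₂ L₁ L₂) {c₀ C R₀ : ℝ}
    (h : BilayerWallResidualFaultedCoreOnAt Rem c₀ C R₀) : BilayerWallResidualFaultedCoreOnAt Rem' c₀ C R₀ :=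
  fun σ₁ σ₂ hσ₁ hσ₂ hf L₁ L₂ s₁ s₂ A₁ A₂ u₁ u₂ hA₁ hA₂ hres hrem c m hadm hleaf =>
    h σ₁ σ₂ hσ₁ hσ₂ hf L₁ L₂ s₁ s₂ A₁ A₂ u₁ u₂ hA₁ hA₂ hres (hle σ₁ σ₂ L₁ L₂ hrem) c m hadm hleaf

/-- **Union of two remainder regions**: cores on `Rem₁` (constant `C₁`) and on `Rem₂` (constant `C₂`) give the core on `Rem₁ ∨ Rem₂` at `max C₁ C₂`
(`R₀ ≥ 0`). -/
theorem residualFaultedCoreOnAt_union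
    {Rem₁ Rem₂ : (ℤ → ℤ) → (ℤ → ℤ) → (E3 ≃ₗᵢ[ℝ] E3) → (E3 ≃ₗᵢ[ℝ] E3) → Prop} {c₀ C₁ C₂ R₀ : ℝ} (hR₀ : 0 ≤ R₀)
    (h₁ : BilayerWallResidualFaultedCoreOnAt Rem₁ c₀ C₁ R₀) (h₂ : BilayerWallResidualFaultedCoreOnAt Rem₂ c₀ C₂ R₀) :
    BilayerWallResidualFaultedCoreOnAt (fun σ₁ σ₂ L₁ L₂ => Rem₁ σ₁ σ₂ L₁ L₂ ∨ Rem₂ σ₁ σ₂ L₁ L₂) c₀ (max C₁ C₂) R₀ := by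
  intro σ₁ σ₂ hσ₁ hσ₂ hf L₁ L₂ s₁ s₂ A₁ A₂ u₁ u₂ hA₁ hA₂ hres hrem c m hadm hleaf
  rcases hrem with h | h
  · exact bilayerWallAt_mono hR₀ (le_max_left _ _) (h₁ σ₁ σ₂ hσ₁ hσ₂ hf L₁ L₂ s₁ s₂ A₁ A₂ u₁ u₂ hA₁ hA₂ hres h c m hadm hleaf)
  · exact bilayerWallAt_mono hR₀ (le_max_right _ _) (h₂ σ₁ σ₂ hσ₁ hσ₂ hf L₁ L₂ s₁ s₂ A₁ A₂ u₁ u₂ hA₁ hA₂ hres h c m hadm hleaf)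

/-- **The identity certificate**: on the regime «one-sidedly certified» every pair is one-sidedly certified. -/
theorem coverageBarlowOn_certified (c₀ : ℝ) : ResidualOneSidedCoverageBarlowOn (BarlowOneSidedCertified c₀) c₀ :=
  fun _ _ _ _ _ _ _ h => h

/-! ## The cut along an arbitrary certified predicate with a K1a closer -/

open scoped Classical in
/-- **Core = (closed cell on `Cert`) + (core on `¬Cert`)**, for ANY orientation predicate `Cert` that some ledger closes for every `c₀`-admissible table
(`BilayerWallFaultedOnAt Cert c₀ C_K R₀`: canonical K1a today via `faultedOnAt_of_coverageBarlowOn`; the chosen-slot menu / steered families tomorrow) and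
the core on its complement split as «edge-on» ∪ «not edge-on but uncertified» (`R₀ ≥ 0`). -/
theorem residualFaultedCoreAt_of_certCut
    {Cert : (ℤ → ℤ) → (ℤ → ℤ) → (E3 ≃ₗᵢ[ℝ] E3) → (E3 ≃ₗᵢ[ℝ] E3) → Prop} {c₀ C_K R₀ : ℝ} (hR₀ : 0 ≤ R₀)
    (hK : BilayerWallFaultedOnAt Cert c₀ C_K R₀)
    (hholes : ∃ C : ℝ, BilayerWallResidualFaultedCoreOnAt
      (fun σ₁ σ₂ L₁ L₂ => ¬ EdgeOnAt c₀ σ₁ σ₂ L₁ L₂ ∧ ¬ Cert σ₁ σ₂ L₁ L₂) c₀ C R₀)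
    (hK4 : ∃ C : ℝ, BilayerWallResidualFaultedEdgeOnAt c₀ C R₀) :
    ∃ C : ℝ, BilayerWallResidualFaultedCoreAt c₀ C R₀ := by
  obtain ⟨C_h, hh⟩ := hholes
  obtain ⟨C_e, he⟩ := hK4
  -- the core on `¬Cert` from the two pieces
  have hrem : BilayerWallResidualFaultedCoreOnAt (fun σ₁ σ₂ L₁ L₂ => ¬ Cert σ₁ σ₂ L₁ L₂) c₀ (max C_h C_e) R₀ :=
    residualFaultedCoreOnAt_anti (Rem := fun σ₁ σ₂ L₁ L₂ =>
        (¬ EdgeOnAt c₀ σ₁ σ₂ L₁ L₂ ∧ ¬ Cert σ₁ σ₂ L₁ L₂) ∨ EdgeOnAt c₀ σ₁ σ₂ L₁ L₂)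
      (fun σ₁ σ₂ L₁ L₂ hnc => by
        by_cases hE : EdgeOnAt c₀ σ₁ σ₂ L₁ L₂
        · exact Or.inr hE
        · exact Or.inl ⟨hE, hnc⟩)
      (residualFaultedCoreOnAt_union hR₀ hh he)
  exact ⟨_, residualFaultedCoreAt_of_split (Reg := Cert) (Rem := fun σ₁ σ₂ L₁ L₂ => ¬ Cert σ₁ σ₂ L₁ L₂)
    (fun σ₁ σ₂ L₁ L₂ => em _) hR₀ hK hrem⟩

/-! ## The semantic cut, canonical slots -/

/-- **THE SEMANTIC CUT, `ExactOnly` form** (`R₀ ≥ 6`): E1-data, the star facts, the core on the read holes `¬EdgeOnAt c₀ ∧ ¬BarlowOneSidedCertified c₀`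
and K4 `∃ C, BilayerWallResidualFaultedEdgeOnAt c₀ C R₀` give the registered core — the certified pairs are CLOSED by lane G's K1a
(`faultedOnAt_of_coverageBarlowOn` on the identity certificate), with no certificate hypothesis at all. -/
theorem residualFaultedCoreAt_of_semanticCut {sE : E3} (hsE : sE ∈ fccSlots)
    (hcert : ExactOnly 0 (fccSlots.filter fun w => 0 < ⟪w, sE⟫_ℝ))
    (hDS : ∀ F₁ F₂ : E3 ≃ₗᵢ[ℝ] E3, DoubleStarCoaxialAt F₁ F₂) (hCP : CapPairCoaxial) {c₀ R₀ : ℝ} (hR₀ : 6 ≤ R₀)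
    (hholes : ∃ C : ℝ, BilayerWallResidualFaultedCoreOnAt
      (fun σ₁ σ₂ L₁ L₂ => ¬ EdgeOnAt c₀ σ₁ σ₂ L₁ L₂ ∧ ¬ BarlowOneSidedCertified c₀ σ₁ σ₂ L₁ L₂) c₀ C R₀)
    (hK4 : ∃ C : ℝ, BilayerWallResidualFaultedEdgeOnAt c₀ C R₀) :
    ∃ C : ℝ, BilayerWallResidualFaultedCoreAt c₀ C R₀ :=
  residualFaultedCoreAt_of_certCut (by linarith)
    (faultedOnAt_of_coverageBarlowOn hsE hcert hDS hCP (coverageBarlowOn_certified c₀) hR₀) hholes hK4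

/-- **THE SEMANTIC CUT, named-fact form**: `P5Exhaustion → StarPairFar → (∃ C, core on ¬EdgeOn ∧ ¬Certified) → (∃ C, K4) → ∃ C, core` (`R₀ ≥ 6`). -/
theorem residualFaultedCoreAt_of_semanticCut' (hE1 : P5Exhaustion) (hSP : StarPairFar) {c₀ R₀ : ℝ} (hR₀ : 6 ≤ R₀)
    (hholes : ∃ C : ℝ, BilayerWallResidualFaultedCoreOnAt
      (fun σ₁ σ₂ L₁ L₂ => ¬ EdgeOnAt c₀ σ₁ σ₂ L₁ L₂ ∧ ¬ BarlowOneSidedCertified c₀ σ₁ σ₂ L₁ L₂) c₀ C R₀)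
    (hK4 : ∃ C : ℝ, BilayerWallResidualFaultedEdgeOnAt c₀ C R₀) :
    ∃ C : ℝ, BilayerWallResidualFaultedCoreAt c₀ C R₀ := by
  obtain ⟨sE, hsE, hcert⟩ := exactOnly_star_of_p5Exhaustion hE1
  exact residualFaultedCoreAt_of_semanticCut hsE hcert (doubleStarCoaxialAt_of_starPairFar hSP)
    (capPairCoaxial_of_starPairFar hSP) hR₀ hholes hK4

/-- **`stub_residualFaultedCore` BY NAME from the semantic cut at `(13/25, 10)`**: {E1, StarPairFar, the read-hole core
`∃ C, BilayerWallResidualFaultedCoreOnAt (¬EdgeOnAt (13/25) ∧ ¬BarlowOneSidedCertified (13/25)) (13/25) C 10`, v8.3's frozen `stub_edgeOn`}. -/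
theorem stub_residualFaultedCore_of_semanticCut (hE1 : P5Exhaustion) (hSP : StarPairFar)
    (hholes : ∃ C : ℝ, BilayerWallResidualFaultedCoreOnAt
      (fun σ₁ σ₂ L₁ L₂ => ¬ EdgeOnAt (13 / 25) σ₁ σ₂ L₁ L₂ ∧ ¬ BarlowOneSidedCertified (13 / 25) σ₁ σ₂ L₁ L₂) (13 / 25) C 10)
    (hK4 : ∃ C : ℝ, BilayerWallResidualFaultedEdgeOnAt (13 / 25) C 10) :
    ∃ C : ℝ, BilayerWallResidualFaultedCoreAt (13 / 25) C 10 :=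
  residualFaultedCoreAt_of_semanticCut' hE1 hSP (by norm_num) hholes hK4

/-! ## Comparison with a certificate on a described regime (cf-p1 (cvi)(3): `RegK3 := ¬EdgeOn ∧ NonExceptional`) -/

/-- **The semantic read holes are the SMALLER region.**  If a certificate covers the regime `¬EdgeOnAt c₀ ∧ N` (any describing predicate `N`, e.g. the
K3 engine's word-uniform `NonExceptional`), then every pair in the semantic read holes `¬EdgeOnAt c₀ ∧ ¬BarlowOneSidedCertified c₀` lies in the described
holes `¬EdgeOnAt c₀ ∧ ¬N`; hence the core on the described holes (the `stub_readHoles` of (cvi)) GIVES the core on the semantic holes — the semantic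
registration is the weaker obligation, and it needs no list. -/
theorem residualFaultedCoreOnAt_semanticHoles_of_coverageOn
    {N : (ℤ → ℤ) → (ℤ → ℤ) → (E3 ≃ₗᵢ[ℝ] E3) → (E3 ≃ₗᵢ[ℝ] E3) → Prop} {c₀ C R₀ : ℝ}
    (hcov : ResidualOneSidedCoverageBarlowOn (fun σ₁ σ₂ L₁ L₂ => ¬ EdgeOnAt c₀ σ₁ σ₂ L₁ L₂ ∧ N σ₁ σ₂ L₁ L₂) c₀)
    (h : BilayerWallResidualFaultedCoreOnAt (fun σ₁ σ₂ L₁ L₂ => ¬ EdgeOnAt c₀ σ₁ σ₂ L₁ L₂ ∧ ¬ N σ₁ σ₂ L₁ L₂) c₀ C R₀) :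
    BilayerWallResidualFaultedCoreOnAt
      (fun σ₁ σ₂ L₁ L₂ => ¬ EdgeOnAt c₀ σ₁ σ₂ L₁ L₂ ∧ ¬ BarlowOneSidedCertified c₀ σ₁ σ₂ L₁ L₂) c₀ C R₀ :=
  fun σ₁ σ₂ hσ₁ hσ₂ hf L₁ L₂ s₁ s₂ A₁ A₂ u₁ u₂ hA₁ hA₂ hres hrem c m hadm hleaf =>
    h σ₁ σ₂ hσ₁ hσ₂ hf L₁ L₂ s₁ s₂ A₁ A₂ u₁ u₂ hA₁ hA₂ hres
      ⟨hrem.1, fun hN => hrem.2 (hcov σ₁ σ₂ hσ₁ hσ₂ hf L₁ L₂ ⟨hrem.1, hN⟩)⟩ c m hadm hleaf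

/-- **… so (cvi)'s three inputs also close the core through the semantic cut** (`R₀ ≥ 6`): a certificate on `¬EdgeOn ∧ N`, the core on `¬EdgeOn ∧ ¬N`,
and K4 — with the list-dependent certificate used only to TRANSPORT the described hole stub to the semantic one. -/
theorem residualFaultedCoreAt_of_describedCut (hE1 : P5Exhaustion) (hSP : StarPairFar)
    {N : (ℤ → ℤ) → (ℤ → ℤ) → (E3 ≃ₗᵢ[ℝ] E3) → (E3 ≃ₗᵢ[ℝ] E3) → Prop} {c₀ R₀ : ℝ} (hR₀ : 6 ≤ R₀)
    (hcov : ResidualOneSidedCoverageBarlowOn (fun σ₁ σ₂ L₁ L₂ => ¬ EdgeOnAt c₀ σ₁ σ₂ L₁ L₂ ∧ N σ₁ σ₂ L₁ L₂) c₀)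
    (hholes : ∃ C : ℝ, BilayerWallResidualFaultedCoreOnAt
      (fun σ₁ σ₂ L₁ L₂ => ¬ EdgeOnAt c₀ σ₁ σ₂ L₁ L₂ ∧ ¬ N σ₁ σ₂ L₁ L₂) c₀ C R₀)
    (hK4 : ∃ C : ℝ, BilayerWallResidualFaultedEdgeOnAt c₀ C R₀) :
    ∃ C : ℝ, BilayerWallResidualFaultedCoreAt c₀ C R₀ := by
  obtain ⟨C, hC⟩ := hholes
  exact residualFaultedCoreAt_of_semanticCut' hE1 hSP hR₀ ⟨C, residualFaultedCoreOnAt_semanticHoles_of_coverageOn hcov hC⟩ hK4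

end Summit.Ventures.Crystal3D.Cruxes.TextureLiminf.TexShadow

end
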